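import Literature.AnabelianGeometry.EtaleTheta.CyclotomeZHatAction
import Literature.AnabelianGeometry.AbsoluteAnabelian.ZHatCompletionAdicCompleteness
import HarnessLib

/-!
# The sign `−1 ∈ Ẑ^×` and its action on cyclotomes (inversion); `Ẑ` is commutative

Classical complement to `CyclotomeZHatAction.lean` ([RibesZalesskii2010, Thm 2.7.1] for `Ẑ`; [LANA2026Report,
§6.1 p.31] for the cyclotome `Λ(A) = lim_n A[n]`): the profinite completion `Ẑ` of `ℤ` is commutative
(abc-iut-L4's landed `ZHatCompletion.mul_comm`, `ZHatCompletionAdicCompleteness.lean` — imported, not restated),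
so inversion is an automorphism `−1 ∈ Aut(Ẑ) = Ẑ^×` (`ZHatLevel.negOneAut`, the tree's
`ZHatUnits`); its level-`n` cyclotomic character is `−1` (`levelChar_negOneAut`), it is NOT the identity
(`negOneAut_ne_one`), and it acts on every cyclotome by INVERSION (`cyclotome.zhatTwist_negOneAut`). This is the
subgroup "`{±1} ⊆ Ẑ^×`" of the `{±1}`- versus `Ẑ^×`-orbit contrast of [IUTchII] Cor. 1.12 (iii) / Rmk. 1.11.1 (ii)
(consumers: abc-iut-L6-t1 `GaloisPairRigidityData.orbitA Γ`, the B12 bridge), and it certifies that the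
`Ẑ^×`-action of `CyclotomeZHatAction.lean` is NON-DEGENERATE: the `Ẑ^×`-orbit of any isomorphism out of a
cyclotome with an element of order `> 2` has at least two members (`cyclotome.zhatTwist_negOneAut_ne`).
HONEST FRAMING: classical bookkeeping; nothing here bears on [IUTchIII] Cor. 3.12.
-/

noncomputable section

open CategoryTheory ProfiniteGrp ProfiniteGrp.ProfiniteCompletion

namespace Literature.AnabelianGeometry.EtaleTheta

namespace ZHatLevel

/-- **`−1 ∈ Ẑ^× = Aut(Ẑ)`**: inversion, an automorphism of the (commutative, abc-iut-L4
`ZHatCompletion.mul_comm`) group `Ẑ`. [cite: RibesZalesskii2010, Thm 2.7.1] -/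
def negOneAut : MulAut (completion (GrpCat.of (Multiplicative ℤ))) where
  toFun x := x⁻¹
  invFun x := x⁻¹
  left_inv x := inv_inv x
  right_inv x := inv_inv x
  map_mul' x y := by
    rw [mul_inv_rev, Literature.AnabelianGeometry.AbsoluteAnabelian.ZHatCompletion.mul_comm]

/-- `(−1)(x) = x⁻¹`. [cite: RibesZalesskii2010, Thm 2.7.1] -/
@[simp] theorem negOneAut_apply (x : completion (GrpCat.of (Multiplicative ℤ))) : negOneAut x = x⁻¹ := rfl

/-- `(−1)² = 1` in `Aut(Ẑ)`. [cite: RibesZalesskii2010, Thm 2.7.1] -/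
theorem negOneAut_mul_self : negOneAut * negOneAut = 1 :=
  MulEquiv.ext fun x => by
    change (x⁻¹)⁻¹ = x
    exact inv_inv x

/-- The level-`n` cyclotomic character of `−1` is `−1 ∈ ℤ/nℤ`. [cite: RibesZalesskii2010, Thm 2.7.1] -/
theorem levelChar_negOneAut (n : ℕ+) : levelChar n negOneAut = -1 := by
  rw [levelChar_apply, negOneAut_apply, map_inv, level_eta, toAdd_inv, toAdd_ofAdd, Int.cast_one]

/-- `−1 ≠ 1` in `Aut(Ẑ)` (their level-`3` characters differ). [cite: RibesZalesskii2010, Thm 2.7.1] -/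
theorem negOneAut_ne_one : negOneAut ≠ 1 := by
  intro h
  have h3 := levelChar_negOneAut 3
  rw [h, map_one] at h3
  exact absurd h3 (by decide)

end ZHatLevel

namespace cyclotome

universe u

variable {A : Type u} [CommGroup A]

/-- A torsion element raised to `(−1 mod n)` is its inverse. [cite: LANA2026Report, §6.1 p.31] -/
theorem pow_val_neg_one_eq_inv {a : A} {n : ℕ+} (ha : a ^ (n : ℕ) = 1) :
    a ^ (-1 : ZMod n).val = a⁻¹ := by
  haveI : NeZero (n : ℕ) := NeZero.of_pos n.pos
  apply eq_inv_of_mul_eq_one_left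
  have h1 : a ^ (1 : ZMod n).val = a := by
    rw [ZMod.val_one_eq_one_mod, ← pow_eq_pow_mod 1 ha, pow_one]
  calc a ^ (-1 : ZMod n).val * a = a ^ (-1 : ZMod n).val * a ^ (1 : ZMod n).val := by rw [h1]
    _ = a ^ (((-1 : ZMod n).val + (1 : ZMod n).val) % (n : ℕ)) := by rw [← pow_add, ← pow_eq_pow_mod _ ha]
    _ = a ^ ((-1 : ZMod n) + 1).val := by rw [ZMod.val_add]
    _ = 1 := by rw [neg_add_cancel, ZMod.val_zero, pow_zero]

variable (A)

/-- **`−1 ∈ Ẑ^×` acts on every cyclotome by inversion**: `(−1) · ζ = ζ⁻¹`.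
[cite: LANA2026Report, §6.1 p.31] -/
theorem zhatTwist_negOneAut (ζ : cyclotome A) : zhatTwist A ZHatLevel.negOneAut ζ = ζ⁻¹ :=
  Subtype.ext (funext fun n => by
    rw [zhatTwist_apply_coe, ZHatLevel.levelChar_negOneAut, pow_val_neg_one_eq_inv (cyclotome.pow_eq_one ζ n)]
    rfl)

variable {A}

/-- NON-DEGENERACY of the `Ẑ^×`-action: on a cyclotome with an element `ζ` of order `> 2` (i.e. `ζ ≠ ζ⁻¹`) the
twist by `−1` moves `ζ`; hence for such `Λ(A)` the `Ẑ^×`-orbit of any isomorphism out of `Λ(A)` has at least two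
members. [cite: LANA2026Report, §6.1 p.31] -/
theorem zhatTwist_negOneAut_ne {ζ : cyclotome A} (hζ : ζ ≠ ζ⁻¹) : zhatTwist A ZHatLevel.negOneAut ζ ≠ ζ := by
  rw [zhatTwist_negOneAut]
  exact fun h => hζ h.symm

/-- In particular the orbit `{(u · −) ≫ φ | u ∈ Ẑ^×}` of an isomorphism `φ : Λ(A) ⥲ B` contains the two DISTINCT
members `φ` and `(−1 · −) ≫ φ` as soon as `Λ(A)` has an element of order `> 2`.
[cite: LANA2026Report, §6.1 p.31] -/
theorem trans_zhatTwist_negOneAut_ne {B : Type u} [CommGroup B] (φ : cyclotome A ≃* B) {ζ : cyclotome A}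
    (hζ : ζ ≠ ζ⁻¹) : (zhatTwist A ZHatLevel.negOneAut).trans φ ≠ φ := by
  intro h
  have := MulEquiv.congr_fun h ζ
  rw [MulEquiv.trans_apply] at this
  exact zhatTwist_negOneAut_ne hζ (φ.injective this)

end cyclotome

end Literature.AnabelianGeometry.EtaleTheta

end
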